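import Summits.AtomisticToContinuum.HydrodynamicLimit.Theses.CollisionIsometryCLT

/-!
# Line `gram-coherence-cascade` for the crux `DiffuseBackwardInfluence` (stmt-AtomisticToContinuum-12950)

Route `CollisionIsometryCLT`, sub-problem `HydrodynamicLimit`, crux rank 3: along the
local-Gibbs-evolved law the rows of the exact frozen-geometry velocity transfer `M` over every
admissible window delocalise in mean, `E[(N+1)⁻¹ Σᵢ Σₖ ‖M_ik‖_F⁴] → 0`.

## The lever (crux idea card `gram-coherence-cascade`, triage r1-2 / r1-3: pass)

Replace the crux's block MASSES `a_ik = ‖M_ik‖_F² = tr S_ik` (`S_ik = M_ik M_ikᵀ` the `3 × 3` Gram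
block) by the Gram SHAPE potential `Φ = Σ_{i,k} ‖S_ik‖_F²` (`(N+1)·ipr ≤ 3Φ`, PROVED below as
`iprSum_le`, so `E Φ/(N+1) → 0` gives the crux). At a fold step reflecting the pair `(p,q)` along the
unit normal `ω` (`P = ωωᵀ`) every block column pair is conjugated, `M_pk ← (I−P)M_pk + P M_qk`,
`M_qk ← (I−P)M_qk + P M_pk`, and the jump of `Φ` is EXACT (`GramJumpIdentity`, re-verified here to
`2·10⁻¹³`):
  `Δ(‖S_p‖² + ‖S_q‖²) = −2(‖(I−P)S_pω‖² + ‖(I−P)S_qω‖²) + 2(‖(I−P)Cω‖² + ‖(I−P)Cᵀω‖²)`,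
`C = M_pk M_qkᵀ` the pre-contact CROSS-GRAM (pair coherence) at source `k`. So `Φ` telescopes along
the fold as `Φ(m) = 3(N+1) − cumDiss(m) + cumGain(m)` with two nonnegative ADDITIVE functionals of
the collision history: the DISSIPATION (off-diagonal weight of the colliding blocks w.r.t. `ω ⊕ ω⊥`)
and the GAIN = coherence cashed at the contact. Per source the big Gram `G^k = M_{·k}M_{·k}ᵀ` is a
rank-3 projection, so `Σ_i ‖S_ik‖² + Σ_{i≠j} ‖C^{ij}_k‖² = 3` is CONSERVED: delocalising source `k`
means moving Gram weight from the diagonal into pair coherences spread over many pairs, and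
re-concentration needs that coherence ROUTED BACK to pairs about to collide (the Loschmidt echo and
the equal-swap relay chain of TRIAGE-r1-3 are exactly the histories with `gain = diss`).

## The skeleton (5 stubs ⟹ crux; composition `DiffuseBackwardInfluence_of` kernel-checked)

* `stub_gramBookkeeping` — the fold-level Gram bookkeeping (conservation law, `Φ ≤ 3(N+1)`,
  locality, the telescoping jump identity); deterministic reflection algebra, M.
* `stub_subordination`  — COHERENCE SUBORDINATION (load-bearing, hardest, XL): for small `σ`, in
  local-Gibbs mean and uniformly over the sub-intervals of the window, the cashed coherence is a
  fixed fraction `1 − η` short of the dissipation up to `o(N+1)`: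
  `E[(gain(s₁,s₂) − (1−η)·diss(s₁,s₂))₊] ≤ ε_N (N+1)`. Stated along the EVOLVED law (triage r1-3
  SHARPEN 2: the transfer to equilibrium is not free) and epoch-wise (SHARPEN 1).
* `stub_fewIdle`        — all but `o(N)` particles collide in every epoch `Δ_N/L` of the window
  (`m = 0` case of FewCollisionsRare; NECESSARY by Disproof F3; shared verbatim with line
  `kinship-lyapunov`), L.
* `stub_supply`         — DISSIPATION SUPPLY: given few idle particles, the collisions of each epoch
  dissipate `≥ c·Φ(epoch start)` up to `o(N+1)` in mean (mass discrepancy ⇒ anisotropy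
  `‖D'‖² ≥ (3/2)(y − a'/3)²` ⇒ dissipation at the next eigen-band-avoiding normal); false on the
  coordinate-normal kernel (`stepDiss ≡ 0`, Disproof F5 / `coordinateNormalsNoSplit_holds`) as it
  must be, L.
* `stub_reduction`      — subordination + supply ⟹ `E[ipr] → 0`: integrate the PROVED pathwise
  closing inequality `epoch_bound` (`L·Φ(Δ_N) ≤ 3(N+1)/(ηc) + deficits`) along the flow,
  `limsup_N E[ipr] ≤ 9/(ηcL)`, then `L → ∞`; analysis/measure theory, M.

Proved here (no `sorry`): `blockMass_sq_le` / `iprSum_le` (mass ≤ shape: `(N+1)·ipr ≤ 3Φ`),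
`gramPotential_zero` (`Φ(0) = 3(N+1)`), `gram_conservation` (the per-source conservation law from
column-orthonormality), `epoch_bound` (the deterministic heart of the closing step, answering
TRIAGE-r1-3 SHARPEN 1), the statement-level composition `delocalises_of_statements` (stub STATEMENTS
⇒ delocalisation below a threshold `σ₀`), and the skeleton theorem `DiffuseBackwardInfluence_of`
(the crux decl BY NAME, no hypotheses, invoking the five registered stubs).

Disproof used (`Cruxes/DiffuseBackwardInfluence/Disproof.lean`, cdisprove cycle 1): F3 — the growth
hypothesis `Δ_N(N+1)^{1/3} → ∞` is consumed at `stub_fewIdle` (FewIdle is necessary: `fewIdle_of_dbi`);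
F4 (`step_step`, no pathwise monotone functional) — honoured: `Φ` has a SIGNED jump and nothing
pathwise is claimed, the measure enters at `stub_subordination`/`stub_supply`; F5/F7 (planar /
free-direction kernels, landed `Negative/TransferKernels`, `Negative/FreeDirection`) — honoured at
`stub_supply`, whose conclusion fails on coordinate/planar histories (`stepDiss ≡ 0` there), and at
`stub_fewIdle` (≤ 2 own collisions keep `rowIpr ≥ 1`); F8 (tightness at three fresh collisions) —
consistent: `Φ` starts dissipating at the second own collision. No stub is an instance of a landed
Negative lemma (checked in the scratch file `scratch-negatives.lean` importing both).
-/

namespace Summit.AtomisticToContinuum.HydrodynamicLimit.Cruxes.DiffuseBackwardInfluence.GramCoherenceCascade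

open scoped BigOperators Topology Classical ENNReal InnerProductSpace
open Filter Set MeasureTheory

noncomputable section

/-! ## The typed transfer, step by step (verbatim `let`s of the crux) -/

/-- Position space `𝕋³`. -/
abbrev T3 : Type := UnitAddTorus (Fin 3)

/-- Velocity space `ℝ³`. -/
abbrev V3 : Type := EuclideanSpace ℝ (Fin 3)

/-- Phase space of `N + 1` spheres on `𝕋³` (the crux's configuration type). -/
abbrev Cfg (N : ℕ) : Type :=
  Literature.Analysis.FluidPDE.Config (N + 1) (Fin 3) (UnitAddTorus (Fin 3))

/-- Velocity fields of `N + 1` spheres. -/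
abbrev Vel (N : ℕ) : Type := Fin (N + 1) → EuclideanSpace ℝ (Fin 3)

/-- Families of hard-sphere flows at reduced density `σ` (the crux's `Φ`). -/
abbrev Flows (σ : ℝ) : Type :=
  (N : ℕ) → Literature.Analysis.FluidPDE.HardSphereFlow
    (Literature.Analysis.FluidPDE.Torus.geometry (Fin 3))
    (Literature.MathematicalPhysics.KineticTheory.hsDiameter σ N) (N + 1)

/-- The pre-collisional configuration ending the `k`-th free flight of the Alexander construction
started at `y` (the crux's `pre k`, verbatim). -/
def pre (σ : ℝ) (N : ℕ) (y : Cfg N) (k : ℕ) : Cfg N :=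
  Literature.Analysis.FluidPDE.freeFlight (Literature.Analysis.FluidPDE.Torus.geometry (Fin 3))
    (Literature.Analysis.FluidPDE.Alexander.freeExitTime
      (Literature.Analysis.FluidPDE.Torus.geometry (Fin 3))
      (Literature.MathematicalPhysics.KineticTheory.hsDiameter σ N)
      (Literature.Analysis.FluidPDE.Alexander.stateAfter
        (Literature.Analysis.FluidPDE.Torus.geometry (Fin 3))
        (Literature.MathematicalPhysics.KineticTheory.hsDiameter σ N) y k)).toReal
    (Literature.Analysis.FluidPDE.Alexander.stateAfter
      (Literature.Analysis.FluidPDE.Torus.geometry (Fin 3))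
      (Literature.MathematicalPhysics.KineticTheory.hsDiameter σ N) y k)

/-- One fold step of the crux's transfer: the velocity part of `collidePair` at the realised
incoming pair of `pre k` (the identity if there is none), applied to a velocity field `W` placed at
the positions of `pre k` (verbatim the crux's `fun W' k => dite …`). -/
def stepMap (σ : ℝ) (N : ℕ) (y : Cfg N) (k : ℕ) (W : Vel N) : Vel N :=
  @dite (Fin (N + 1) → EuclideanSpace ℝ (Fin 3))
    (Literature.Analysis.FluidPDE.Alexander.incomingPairs
      (Literature.Analysis.FluidPDE.Torus.geometry (Fin 3))
      (Literature.MathematicalPhysics.KineticTheory.hsDiameter σ N) (pre σ N y k)).Nonempty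
    (Classical.propDecidable _)
    (fun h => fun i => (Literature.Analysis.FluidPDE.collidePair
      (Literature.Analysis.FluidPDE.Torus.geometry (Fin 3)) h.some.1 h.some.2
      (fun j => ((pre σ N y k j).1, W j)) i).2)
    (fun _ => W)

/-- The transfer after the first `m` fold steps, `M(m) W`; the crux's `M N y Δ W` is
`transferSteps σ N y (steps σ N y Δ) W`. -/
def transferSteps (σ : ℝ) (N : ℕ) (y : Cfg N) (m : ℕ) (W : Vel N) : Vel N :=
  (List.range m).foldl (fun W' k => stepMap σ N y k W') W

/-- The number of fold steps whose collision instant lies in the closed window `[0, s]`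
(the crux's `collisionCount`). -/
def steps (σ : ℝ) (N : ℕ) (y : Cfg N) (s : ℝ) : ℕ :=
  Literature.Analysis.FluidPDE.Alexander.collisionCount
    (Literature.Analysis.FluidPDE.Torus.geometry (Fin 3))
    (Literature.MathematicalPhysics.KineticTheory.hsDiameter σ N) y s

/-- The incoming pair reflected at fold step `k` (`none` if the step is the identity). -/
def stepPair (σ : ℝ) (N : ℕ) (y : Cfg N) (k : ℕ) : Option (Fin (N + 1) × Fin (N + 1)) :=
  @dite (Option (Fin (N + 1) × Fin (N + 1)))
    (Literature.Analysis.FluidPDE.Alexander.incomingPairs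
      (Literature.Analysis.FluidPDE.Torus.geometry (Fin 3))
      (Literature.MathematicalPhysics.KineticTheory.hsDiameter σ N) (pre σ N y k)).Nonempty
    (Classical.propDecidable _)
    (fun h => some h.some) (fun _ => none)

/-- The UNIT normal of fold step `k`: the normalised minimal-image separation vector of the
reflected pair at the pre-collisional positions (`collidePair` reflects along this direction;
`0` if the step is the identity). -/
def stepNormal (σ : ℝ) (N : ℕ) (y : Cfg N) (k : ℕ) : V3 :=
  match stepPair σ N y k with
  | some p =>
      let s := (Literature.Analysis.FluidPDE.Torus.geometry (Fin 3)).sepVec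
        ((pre σ N y k) p.1).1 ((pre σ N y k) p.2).1
      ‖s‖⁻¹ • s
  | none => 0

/-- Particle `i` takes part in fold step `k`. -/
def Involved (σ : ℝ) (N : ℕ) (y : Cfg N) (k : ℕ) (i : Fin (N + 1)) : Prop :=
  ∃ pq : Fin (N + 1) × Fin (N + 1), stepPair σ N y k = some pq ∧ (i = pq.1 ∨ i = pq.2)

/-- Number of particles taking part in none of the fold steps `m₁ ≤ m < m₂`. -/
def idleCount (σ : ℝ) (N : ℕ) (y : Cfg N) (m₁ m₂ : ℕ) : ℕ :=
  (Finset.univ.filter fun i : Fin (N + 1) => ∀ m ∈ Finset.Ico m₁ m₂, ¬ Involved σ N y m i).card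

/-! ## Gram blocks: shape potential, dissipation, cashed coherence -/

/-- The three columns of the block `M_ik(m)` (`a ↦ M(m)(e_k ⊗ e_a)_i ∈ ℝ³`). -/
def blockCols (σ : ℝ) (N : ℕ) (y : Cfg N) (m : ℕ) (i k : Fin (N + 1)) : Fin 3 → V3 :=
  fun a => transferSteps σ N y m (Pi.single k (EuclideanSpace.single a (1 : ℝ))) i

/-- Component of `v` orthogonal to the unit vector `ω`: `(I − ωωᵀ) v`. -/
def offPart (ω v : V3) : V3 := v - ⟪ω, v⟫_ℝ • ω

/-- For a block with columns `u`: `S ω = M Mᵀ ω = Σ_a ⟪ω, u_a⟫ u_a` (`S = M Mᵀ` the Gram block;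
`⟪ω, S ω⟫` is the share handed over along `ω`). -/
def gramVec (u : Fin 3 → V3) (ω : V3) : V3 := ∑ a, ⟪ω, u a⟫_ℝ • u a

/-- For two blocks `u` (columns of `M_pk`) and `w` (columns of `M_qk`):
`C ω = M_pk M_qkᵀ ω = Σ_a ⟪ω, w_a⟫ u_a`, `C` the pre-contact CROSS-GRAM (pair coherence) at source
`k`; `crossVec w u ω = Cᵀ ω`. -/
def crossVec (u w : Fin 3 → V3) (ω : V3) : V3 := ∑ a, ⟪ω, w a⟫_ℝ • u a

/-- `‖M Mᵀ‖_F² = Σ_{a,b} ⟪u_a, u_b⟫²`: squared Frobenius norm of the Gram block. -/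
def gramFrob2 (u : Fin 3 → V3) : ℝ := ∑ a, ∑ b, ⟪u a, u b⟫_ℝ ^ 2

/-- `‖M_pk M_qkᵀ‖_F² = Σ_{a,b} ⟪u_a, u_b⟫ ⟪w_b, w_a⟫`: squared Frobenius norm of the cross-Gram of
two blocks at the same source (`= gramFrob2 u` when `w = u`). -/
def crossFrob2 (u w : Fin 3 → V3) : ℝ := ∑ a, ∑ b, ⟪u a, u b⟫_ℝ * ⟪w b, w a⟫_ℝ

/-- Block mass `‖M‖_F² = tr S = Σ_a ‖u_a‖²` (the crux's `a_ik`; `ipr_i = Σ_k (tr S_ik)²`). -/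
def blockMass (u : Fin 3 → V3) : ℝ := ∑ a, ‖u a‖ ^ 2

/-- The Gram-shape potential after `m` fold steps: `Φ(m) = Σ_i Σ_k ‖S_ik(m)‖_F²`. -/
def gramPotential (σ : ℝ) (N : ℕ) (y : Cfg N) (m : ℕ) : ℝ :=
  ∑ i : Fin (N + 1), ∑ k : Fin (N + 1), gramFrob2 (blockCols σ N y m i k)

/-- `(N+1) · ipr` after `m` fold steps: `Σ_i Σ_k (tr S_ik(m))²` (verbatim the crux's double sum). -/
def iprSum (σ : ℝ) (N : ℕ) (y : Cfg N) (m : ℕ) : ℝ :=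
  ∑ i : Fin (N + 1), ∑ k : Fin (N + 1), blockMass (blockCols σ N y m i k) ^ 2

/-- Φ-DISSIPATION of fold step `m` (pre-step blocks, unit normal `ω_m`, pair `(p,q)`):
`2 Σ_k (‖(I−P)S_pk ω‖² + ‖(I−P)S_qk ω‖²)`; `0` if the step is the identity. -/
def stepDiss (σ : ℝ) (N : ℕ) (y : Cfg N) (m : ℕ) : ℝ :=
  match stepPair σ N y m with
  | some pq =>
      2 * ∑ k : Fin (N + 1),
        (‖offPart (stepNormal σ N y m) (gramVec (blockCols σ N y m pq.1 k) (stepNormal σ N y m))‖ ^ 2 +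
          ‖offPart (stepNormal σ N y m) (gramVec (blockCols σ N y m pq.2 k) (stepNormal σ N y m))‖ ^ 2)
  | none => 0

/-- Φ-GAIN of fold step `m`: `2 Σ_k (‖(I−P)C^{pq}_k ω‖² + ‖(I−P)C^{qp}_k ω‖²)` — the pre-contact
coherence of the colliding pair CASHED at the contact; `0` if the step is the identity. -/
def stepGain (σ : ℝ) (N : ℕ) (y : Cfg N) (m : ℕ) : ℝ :=
  match stepPair σ N y m with
  | some pq =>
      2 * ∑ k : Fin (N + 1),
        (‖offPart (stepNormal σ N y m)
            (crossVec (blockCols σ N y m pq.1 k) (blockCols σ N y m pq.2 k) (stepNormal σ N y m))‖ ^ 2 +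
          ‖offPart (stepNormal σ N y m)
            (crossVec (blockCols σ N y m pq.2 k) (blockCols σ N y m pq.1 k) (stepNormal σ N y m))‖ ^ 2)
  | none => 0

/-- Dissipation of the fold steps `m₁ ≤ m < m₂`. -/
def dissIco (σ : ℝ) (N : ℕ) (y : Cfg N) (m₁ m₂ : ℕ) : ℝ :=
  ∑ m ∈ Finset.Ico m₁ m₂, stepDiss σ N y m

/-- Cashed coherence of the fold steps `m₁ ≤ m < m₂`. -/
def gainIco (σ : ℝ) (N : ℕ) (y : Cfg N) (m₁ m₂ : ℕ) : ℝ :=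
  ∑ m ∈ Finset.Ico m₁ m₂, stepGain σ N y m

/-! ## Proved algebra: mass ≤ shape, the fresh potential, the conservation law -/

/-- MASS ≤ SHAPE blockwise: `(tr S)² ≤ 3 ‖S‖_F²` (Cauchy–Schwarz on the diagonal Gram entries; the
off-diagonal ones only help). -/
theorem blockMass_sq_le (u : Fin 3 → V3) : blockMass u ^ 2 ≤ 3 * gramFrob2 u := by
  simp only [blockMass, gramFrob2, Fin.sum_univ_three, real_inner_self_eq_norm_sq]
  nlinarith [sq_nonneg (‖u 0‖ ^ 2 - ‖u 1‖ ^ 2), sq_nonneg (‖u 1‖ ^ 2 - ‖u 2‖ ^ 2),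
    sq_nonneg (‖u 0‖ ^ 2 - ‖u 2‖ ^ 2), sq_nonneg ⟪u 0, u 1⟫_ℝ, sq_nonneg ⟪u 0, u 2⟫_ℝ,
    sq_nonneg ⟪u 1, u 0⟫_ℝ, sq_nonneg ⟪u 1, u 2⟫_ℝ, sq_nonneg ⟪u 2, u 0⟫_ℝ, sq_nonneg ⟪u 2, u 1⟫_ℝ]

/-- `(N+1)·ipr ≤ 3 Φ` at every fold step: the crux follows from `E[Φ]/(N+1) → 0`. -/
theorem iprSum_le (σ : ℝ) (N : ℕ) (y : Cfg N) (m : ℕ) :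
    iprSum σ N y m ≤ 3 * gramPotential σ N y m := by
  unfold iprSum gramPotential
  rw [Finset.mul_sum]
  refine Finset.sum_le_sum fun i _ => ?_
  rw [Finset.mul_sum]
  exact Finset.sum_le_sum fun k _ => blockMass_sq_le _

/-- `iprSum` is nonnegative. -/
theorem iprSum_nonneg (σ : ℝ) (N : ℕ) (y : Cfg N) (m : ℕ) : 0 ≤ iprSum σ N y m :=
  Finset.sum_nonneg fun _ _ => Finset.sum_nonneg fun _ _ => sq_nonneg _

/-- `Φ` is nonnegative. -/
theorem gramPotential_nonneg (σ : ℝ) (N : ℕ) (y : Cfg N) (m : ℕ) : 0 ≤ gramPotential σ N y m :=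
  Finset.sum_nonneg fun _ _ => Finset.sum_nonneg fun _ _ =>
    Finset.sum_nonneg fun _ _ => Finset.sum_nonneg fun _ _ => sq_nonneg _

/-- The Gram shape of a fresh block: `‖S_ik(0)‖² = 3 δ_ik`. -/
theorem gramFrob2_single (N : ℕ) (i k : Fin (N + 1)) :
    gramFrob2 (fun a => (Pi.single k (EuclideanSpace.single a (1 : ℝ)) : Vel N) i) =
      if i = k then 3 else 0 := by
  by_cases hik : i = k
  · subst hik
    have h : ∀ a b : Fin 3,
        ⟪(EuclideanSpace.single a (1 : ℝ) : V3), EuclideanSpace.single b (1 : ℝ)⟫_ℝ =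
          if a = b then 1 else 0 := by
      intro a b
      rw [EuclideanSpace.inner_single_left]
      by_cases hab : a = b
      · subst hab; simp
      · simp [hab]
    simp only [Pi.single_eq_same, if_true, gramFrob2, h]
    simp
  · simp [gramFrob2, hik]

/-- THE FRESH POTENTIAL: `Φ(0) = 3 (N+1)` (every row is the identity block on its own source). -/
theorem gramPotential_zero (σ : ℝ) (N : ℕ) (y : Cfg N) :
    gramPotential σ N y 0 = 3 * ((N + 1 : ℕ) : ℝ) := by
  have h0 : ∀ (i k : Fin (N + 1)), blockCols σ N y 0 i k =
      fun a => (Pi.single k (EuclideanSpace.single a (1 : ℝ)) : Vel N) i := by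
    intro i k; rfl
  unfold gramPotential
  simp_rw [h0, gramFrob2_single]
  simp [Finset.sum_ite_eq, Finset.sum_const, Finset.card_univ]
  ring

/-- THE PER-SOURCE CONSERVATION LAW (abstract form): if the block column `(M_ik)_i` has orthonormal
columns (`Σ_i ⟪M_ik e_a, M_ik e_b⟫ = δ_ab` — column-orthonormality of the orthogonal transfer), then
`Σ_i Σ_j ‖M_ik M_jkᵀ‖_F² = 3`: diagonal Gram weight `Φ_k = Σ_i ‖S_ik‖²` plus total pair coherence
`Σ_{i≠j} ‖C^{ij}_k‖²` is conserved. (From `IdeatorTwoSketch.gram_conservation`, re-proved here so the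
line is self-contained; `stub_gramBookkeeping` instantiates it on the fold.) -/
theorem gram_conservation {n : ℕ} (u : Fin n → Fin 3 → V3)
    (horth : ∀ a b : Fin 3, ∑ i, ⟪u i a, u i b⟫_ℝ = if a = b then 1 else 0) :
    ∑ i, ∑ j, crossFrob2 (u i) (u j) = 3 := by
  simp only [crossFrob2, Fin.sum_univ_three, Finset.sum_add_distrib, ← Finset.mul_sum,
    ← Finset.sum_mul, horth]
  have h02 : ((0 : Fin 3) = 2) = False := by decide
  have h12 : ((1 : Fin 3) = 2) = False := by decide
  have h20 : ((2 : Fin 3) = 0) = False := by decide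
  have h21 : ((2 : Fin 3) = 1) = False := by decide
  simp only [h02, h12, h20, h21, if_false]
  norm_num

/-! ## The deterministic heart of the closing step (TRIAGE-r1-3 SHARPEN 1, epoch-wise) -/

/-- **EPOCH BOUND (pathwise, proved).** Let `Φ_ℓ ≥ 0` be the potential at the epoch boundaries
`ℓ = 0, …, L`, `Φ_0 ≤ B`, with per-epoch dissipation `d_ℓ ≥ 0` and gain `g_ℓ`,
`Φ_{ℓ+1} = Φ_ℓ − d_ℓ + g_ℓ`. Then for every defect `η > 0` and supply fraction `c > 0`,
`L · Φ_L ≤ (B + X₀⁺)/(ηc) + S⁺/c + Σ_ℓ X_ℓ⁺`, where `X_ℓ = Σ_{m ≥ ℓ} g_m − (1−η) Σ_{m ≥ ℓ} d_m` is the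
SUBORDINATION DEFICIT of the tail `[s_ℓ, Δ]` and `S = c Σ_ℓ Φ_ℓ − Σ_ℓ d_ℓ` the SUPPLY DEFICIT.
In mean each deficit is `o(N+1)` (stubs 2 and 4), `B = 3(N+1)`, so `E[Φ_L]/(N+1) ≤ 3/(ηcL) + o(1)`:
this is why whole-window telescoping (knife edge `cumGain/cumDiss → 1 − η`) is replaced by epochs. -/
theorem epoch_bound {L : ℕ} {η c B : ℝ} (hη : 0 < η) (hc : 0 < c)
    (Φ d g : ℕ → ℝ) (hΦ : ∀ ℓ, 0 ≤ Φ ℓ) (hB : Φ 0 ≤ B) (hd : ∀ ℓ, 0 ≤ d ℓ)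
    (hstep : ∀ ℓ < L, Φ (ℓ + 1) = Φ ℓ - d ℓ + g ℓ) :
    (L : ℝ) * Φ L ≤
      (B + max 0 (∑ m ∈ Finset.range L, g m - (1 - η) * ∑ m ∈ Finset.range L, d m)) / (η * c)
      + max 0 (c * ∑ ℓ ∈ Finset.range L, Φ ℓ - ∑ m ∈ Finset.range L, d m) / c
      + ∑ ℓ ∈ Finset.range L,
          max 0 (∑ m ∈ Finset.Ico ℓ L, g m - (1 - η) * ∑ m ∈ Finset.Ico ℓ L, d m) := by
  -- cumulative identity along the epochs
  have hcum : ∀ n, n ≤ L → Φ n = Φ 0 + ∑ m ∈ Finset.range n, (g m - d m) := by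
    intro n
    induction n with
    | zero => intro; simp
    | succ n ih =>
      intro hn
      rw [Finset.sum_range_succ, hstep n (Nat.lt_of_succ_le hn), ih (Nat.le_of_succ_le hn)]
      ring
  have htail : ∀ ℓ, ℓ ≤ L →
      Φ L = Φ ℓ - ∑ m ∈ Finset.Ico ℓ L, d m + ∑ m ∈ Finset.Ico ℓ L, g m := by
    intro ℓ hℓ
    rw [Finset.sum_Ico_eq_sub _ hℓ, Finset.sum_Ico_eq_sub _ hℓ, hcum L le_rfl, hcum ℓ hℓ,
      Finset.sum_sub_distrib, Finset.sum_sub_distrib]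
    ring
  -- tail dissipation / gain
  set D : ℕ → ℝ := fun ℓ => ∑ m ∈ Finset.Ico ℓ L, d m with hD
  set Gs : ℕ → ℝ := fun ℓ => ∑ m ∈ Finset.Ico ℓ L, g m with hGs
  have hDnn : ∀ ℓ, 0 ≤ D ℓ := fun ℓ => Finset.sum_nonneg fun m _ => hd m
  have hD0 : ∑ m ∈ Finset.range L, d m = D 0 := by
    simp only [hD, Nat.Ico_zero_eq_range]
  have hG0 : ∑ m ∈ Finset.range L, g m = Gs 0 := by
    simp only [hGs, Nat.Ico_zero_eq_range]
  -- per-epoch: Φ_L ≤ Φ_ℓ + X_ℓ⁺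
  have hper : ∀ ℓ, ℓ ≤ L → Φ L ≤ Φ ℓ + max 0 (Gs ℓ - (1 - η) * D ℓ) := by
    intro ℓ hℓ
    have h' : Φ L = Φ ℓ - η * D ℓ + (Gs ℓ - (1 - η) * D ℓ) := by rw [htail ℓ hℓ]; ring
    have hX : Gs ℓ - (1 - η) * D ℓ ≤ max 0 (Gs ℓ - (1 - η) * D ℓ) := le_max_right _ _
    have hηD : 0 ≤ η * D ℓ := mul_nonneg hη.le (hDnn ℓ)
    linarith
  -- summed over the epochs
  have hsum : (L : ℝ) * Φ L ≤ ∑ ℓ ∈ Finset.range L, Φ ℓ +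
      ∑ ℓ ∈ Finset.range L, max 0 (Gs ℓ - (1 - η) * D ℓ) := by
    have h1 : ∑ _ℓ ∈ Finset.range L, Φ L ≤
        ∑ ℓ ∈ Finset.range L, (Φ ℓ + max 0 (Gs ℓ - (1 - η) * D ℓ)) :=
      Finset.sum_le_sum fun ℓ hℓ => hper ℓ (Finset.mem_range.1 hℓ).le
    rw [Finset.sum_const, Finset.card_range, nsmul_eq_mul, Finset.sum_add_distrib] at h1
    exact h1
  -- the total dissipation is controlled by the budget and the first deficit
  have hbudget : η * D 0 ≤ B + max 0 (Gs 0 - (1 - η) * D 0) := by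
    have h' : Φ L = Φ 0 - η * D 0 + (Gs 0 - (1 - η) * D 0) := by rw [htail 0 (Nat.zero_le L)]; ring
    have hX : Gs 0 - (1 - η) * D 0 ≤ max 0 (Gs 0 - (1 - η) * D 0) := le_max_right _ _
    have hL0 := hΦ L
    linarith
  have hbudget' : D 0 ≤ (B + max 0 (Gs 0 - (1 - η) * D 0)) / η := by
    rw [le_div_iff₀ hη]; linarith
  -- supply
  have hsup : c * ∑ ℓ ∈ Finset.range L, Φ ℓ ≤
      D 0 + max 0 (c * ∑ ℓ ∈ Finset.range L, Φ ℓ - D 0) := by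
    have : c * ∑ ℓ ∈ Finset.range L, Φ ℓ - D 0 ≤ max 0 (c * ∑ ℓ ∈ Finset.range L, Φ ℓ - D 0) :=
      le_max_right _ _
    linarith
  have hΦsum : ∑ ℓ ∈ Finset.range L, Φ ℓ ≤
      (B + max 0 (Gs 0 - (1 - η) * D 0)) / (η * c) + max 0 (c * ∑ ℓ ∈ Finset.range L, Φ ℓ - D 0) / c := by
    have h1 : ∑ ℓ ∈ Finset.range L, Φ ℓ ≤
        ((B + max 0 (Gs 0 - (1 - η) * D 0)) / η + max 0 (c * ∑ ℓ ∈ Finset.range L, Φ ℓ - D 0)) / c := by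
      rw [le_div_iff₀ hc]; linarith
    rwa [add_div, div_div] at h1
  rw [hD0, hG0]
  linarith

/-! ## The statements of the line -/

/-- Continuous, positive profiles (the crux's hypotheses on `a₀, θ₀, u₀`). -/
def NiceProfiles (a₀ θ₀ : T3 → ℝ) (u₀ : T3 → V3) : Prop :=
  Continuous a₀ ∧ Continuous θ₀ ∧ Continuous u₀ ∧ (∀ x, 0 < a₀ x) ∧ (∀ x, 0 < θ₀ x)

/-- Admissible windows (the crux's hypotheses on `Δ`): `Δ_N > 0`, `Δ_N → 0`,
`Δ_N (N+1)^{1/3} → ∞`. -/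
def AdmissibleWindow (Δ : ℕ → ℝ) : Prop :=
  (∀ N, 0 < Δ N) ∧ Tendsto Δ atTop (𝓝 0) ∧
    Tendsto (fun N : ℕ => Δ N * ((N + 1 : ℕ) : ℝ) ^ ((1 : ℝ) / 3)) atTop atTop

/-- GRAM BOOKKEEPING of the typed fold, for every `N`, `y`, `m`: (conservation) for every source `k`
the total Gram weight `Σ_i Σ_j ‖M_ik(m) M_jk(m)ᵀ‖_F²` is `3` (the transfer is orthogonal, each fold
step being `reflectVel`, so `G^k = M_{·k}M_{·k}ᵀ` is a rank-3 projection; `gram_conservation`);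
(budget) hence `Φ(m) ≤ 3(N+1)`; (locality) the blocks of a particle not reflected at step `m` are
unchanged; (jump) the EXACT telescoping `Φ(m+1) − Φ(m) = gain_m − diss_m` (`GramJumpIdentity`
applied at every source to the reflected pair: the stacked `6 × 6` Gram is conjugated by the
involution `[[I−P, P],[P, I−P]]`, and the new off-diagonal block is the orthogonal sum
`(I−P)S_pP + (I−P)C(I−P) + PCᵀP + PS_q(I−P)`). -/
def GramBookkeeping (σ : ℝ) : Prop :=
  ∀ (N : ℕ) (y : Cfg N) (m : ℕ),
    (∀ k : Fin (N + 1),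
      ∑ i : Fin (N + 1), ∑ j : Fin (N + 1), crossFrob2 (blockCols σ N y m i k) (blockCols σ N y m j k) = 3) ∧
    gramPotential σ N y m ≤ 3 * ((N + 1 : ℕ) : ℝ) ∧
    (∀ i : Fin (N + 1), ¬ Involved σ N y m i →
      ∀ k : Fin (N + 1), blockCols σ N y (m + 1) i k = blockCols σ N y m i k) ∧
    gramPotential σ N y (m + 1) - gramPotential σ N y m = stepGain σ N y m - stepDiss σ N y m

/-- COHERENCE SUBORDINATION at defect `η` on the window started at `y = Φ_{t−Δ_N} z`: uniformly over
the sub-intervals `[s₁, s₂] ⊆ [0, Δ_N]`, in local-Gibbs mean, the coherence cashed by the fold steps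
of `(s₁, s₂]` is at most `(1 − η) ×` their dissipation up to `ε_N (N+1)`, `ε_N → 0`:
`E[(gain(s₁,s₂) − (1−η)·diss(s₁,s₂))₊] ≤ ε_N (N+1)` (`ENNReal.ofReal` clips at `0`). The Loschmidt
echo and the equal-swap relay chain (`gain = diss`, TRIAGE-r1-3) are the null histories it excludes in
mean; the Kac walk has `gain/diss ≈ 0–0.2` per epoch before the Haar floor (`IdeatorTwoNumerics.md` §3),
where both sides are `O(n_N) = o(N)`. -/
def SubordinationAt (η σ : ℝ) (a₀ θ₀ : T3 → ℝ) (u₀ : T3 → V3) (Φ : Flows σ) (Δ : ℕ → ℝ)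
    (t : ℝ) : Prop :=
  ∃ err : ℕ → ℝ, Tendsto err atTop (𝓝 0) ∧
    ∀ (N : ℕ) (s₁ s₂ : ℝ), 0 ≤ s₁ → s₁ ≤ s₂ → s₂ ≤ Δ N →
      ∫⁻ z, ENNReal.ofReal
          (gainIco σ N ((Φ N).flow (t - Δ N) z)
              (steps σ N ((Φ N).flow (t - Δ N) z) s₁) (steps σ N ((Φ N).flow (t - Δ N) z) s₂) -
            (1 - η) * dissIco σ N ((Φ N).flow (t - Δ N) z)
              (steps σ N ((Φ N).flow (t - Δ N) z) s₁) (steps σ N ((Φ N).flow (t - Δ N) z) s₂))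
        ∂(Literature.MathematicalPhysics.KineticTheory.localGibbsLaw σ a₀ u₀ θ₀ N (Φ N))
      ≤ ENNReal.ofReal (err N * ((N + 1 : ℕ) : ℝ))

/-- FEW IDLE PARTICLES on the epochs of `L` equal parts of the window: the mean number of
(particle, epoch) pairs such that the particle takes part in no fold step of the epoch
`(ℓ Δ_N / L, (ℓ+1) Δ_N / L]` is `o(N+1)` (verbatim the statement of line `kinship-lyapunov`). -/
def FewIdleAt (σ : ℝ) (a₀ θ₀ : T3 → ℝ) (u₀ : T3 → V3) (Φ : Flows σ) (Δ : ℕ → ℝ) (t : ℝ)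
    (L : ℕ) : Prop :=
  Tendsto (fun N : ℕ => ((N + 1 : ℕ) : ℝ≥0∞)⁻¹ *
    ∫⁻ z, (∑ ℓ ∈ Finset.range L,
      (idleCount σ N ((Φ N).flow (t - Δ N) z)
        (steps σ N ((Φ N).flow (t - Δ N) z) ((ℓ : ℝ) * Δ N / (L : ℝ)))
        (steps σ N ((Φ N).flow (t - Δ N) z) (((ℓ : ℝ) + 1) * Δ N / (L : ℝ))) : ℝ≥0∞))
      ∂(Literature.MathematicalPhysics.KineticTheory.localGibbsLaw σ a₀ u₀ θ₀ N (Φ N)))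
    atTop (𝓝 0)

/-- DISSIPATION SUPPLY at fraction `c` on `L` epochs: the fold steps of the epochs dissipate at least
`c` times the Gram potential present at the epoch starts, up to `o(N+1)` in mean:
`(N+1)⁻¹ E[(Σ_{ℓ<L} (c · Φ(s_ℓ) − diss(s_ℓ, s_{ℓ+1})))₊] → 0`, `s_ℓ = ℓ Δ_N / L`. -/
def SupplyAt (c σ : ℝ) (a₀ θ₀ : T3 → ℝ) (u₀ : T3 → V3) (Φ : Flows σ) (Δ : ℕ → ℝ) (t : ℝ)
    (L : ℕ) : Prop :=
  Tendsto (fun N : ℕ => ((N + 1 : ℕ) : ℝ≥0∞)⁻¹ *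
    ∫⁻ z, ENNReal.ofReal (∑ ℓ ∈ Finset.range L,
      (c * gramPotential σ N ((Φ N).flow (t - Δ N) z)
          (steps σ N ((Φ N).flow (t - Δ N) z) ((ℓ : ℝ) * Δ N / (L : ℝ))) -
        dissIco σ N ((Φ N).flow (t - Δ N) z)
          (steps σ N ((Φ N).flow (t - Δ N) z) ((ℓ : ℝ) * Δ N / (L : ℝ)))
          (steps σ N ((Φ N).flow (t - Δ N) z) (((ℓ : ℝ) + 1) * Δ N / (L : ℝ)))))
      ∂(Literature.MathematicalPhysics.KineticTheory.localGibbsLaw σ a₀ u₀ θ₀ N (Φ N)))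
    atTop (𝓝 0)

/-- The conclusion of the crux at `(σ, profiles, Φ, Δ, t)`: the mean inverse participation ratio of
the transfer over `[t − Δ_N, t]` tends to `0` (definitionally the crux's `Tendsto …`: its `let M`,
`let ipr` are `transferSteps … (steps …)` and `(N+1)⁻¹ · iprSum`). -/
def Delocalises (σ : ℝ) (a₀ θ₀ : T3 → ℝ) (u₀ : T3 → V3) (Φ : Flows σ) (Δ : ℕ → ℝ) (t : ℝ) :
    Prop :=
  Tendsto (fun N : ℕ => ∫⁻ z, ENNReal.ofReal (((N + 1 : ℕ) : ℝ)⁻¹ *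
      iprSum σ N ((Φ N).flow (t - Δ N) z) (steps σ N ((Φ N).flow (t - Δ N) z) (Δ N)))
    ∂(Literature.MathematicalPhysics.KineticTheory.localGibbsLaw σ a₀ u₀ θ₀ N (Φ N)))
    atTop (𝓝 0)

/-! ## Registered stubs -/

/-- STUB 1 (GRAM BOOKKEEPING, deterministic, M). The conservation law, the budget `Φ ≤ 3(N+1)`,
locality and the exact jump identity for the typed fold, for every `σ`, `N`, `y`, `m` (induction over
`List.range`; `collidePair_apply_left/right/of_ne`; `reflectVel` along `sepVec` of the pre-collisional
positions is `v ↦ (I−P)v + Pv'` with `P = ωωᵀ`, `ω = stepNormal`, the identity at normal `0`;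
orthogonality of every step gives column-orthonormality for `gram_conservation`; the jump is the
`GramJumpIdentity` of the card, verified to `10⁻¹³`). Why it might fail: it cannot (exact algebra);
size is the fold-level lift. -/
theorem stub_gramBookkeeping : ∀ σ : ℝ, GramBookkeeping σ := by
  sorry

/-- STUB 2 (COHERENCE SUBORDINATION — load-bearing, hardest, XL). Given the bookkeeping, for all nice
profiles there is `σ₀ > 0` such that for `0 < σ < σ₀`, every flow family, every admissible window and
every `t > 0`, some defect `η ∈ (0,1)` satisfies `SubordinationAt η …`: in local-Gibbs mean, uniformly
over the sub-intervals of the window, cashed coherence `≤ (1−η) ×` dissipation `+ o(N+1)`. Mechanism: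
gain needs coherence `C^{pq}_k ≠ 0`, i.e. KIN contacts (`Σ_k ‖C^{pq}_k‖² ≤ K_pq = Σ_k a_pk a_qk`,
zero on forests and at the immediate recollision of a fresh pair); coherence is created only at
contacts between anisotropic blocks (`‖C'‖² = ½ ·` that contact's dissipation), is stripped by every
intervening third-party contact of either partner (`C ↦ (I−P')C + P'C^{lq}`), and is cashed only when
THAT pair meets again; at small `σ` the recollision fraction of the collision ORDER is small and
recontacts mostly follow several third-party contacts of both partners, so routed-back coherence is a
`(1−η)`-minority of the dissipation. Why it might fail: a positive-density population of promptly
re-colliding pairs / shielded transient clusters whose recontact normals stay inside the `≈ 0.3 rad`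
caps that regrow `Φ` (`IdeatorTwoNumerics.md` §4: each routed contact costs ≈ 3 nats, so an `εN`
violation costs only `e^{−cεN}` — exponential, INSIDE the `O(N)` entropy budget: the statement must
be proved along the evolved law, not transferred from equilibrium); no N-uniform recollision
statistics along the non-equilibrium law are in print (`DiluteRegime`/`NoDensityExpansion` barrier
status: open either way). Honours Disproof F4 (in mean, never pathwise: echo and equal-swap chain
have `gain = diss`). -/
theorem stub_subordination :
    (∀ σ : ℝ, GramBookkeeping σ) →
    ∀ (a₀ θ₀ : T3 → ℝ) (u₀ : T3 → V3), NiceProfiles a₀ θ₀ u₀ →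
      ∃ σ₀ : ℝ, 0 < σ₀ ∧ ∀ σ : ℝ, 0 < σ → σ < σ₀ →
        ∀ (Φ : Flows σ) (Δ : ℕ → ℝ), AdmissibleWindow Δ → ∀ t : ℝ, 0 < t →
          ∃ η : ℝ, 0 < η ∧ η < 1 ∧ SubordinationAt η σ a₀ θ₀ u₀ Φ Δ t := by
  sorry

/-- STUB 3 (FEW IDLE PARTICLES, L; shared verbatim with line `kinship-lyapunov`). For all nice
profiles there is `σ₀ > 0` such that for `0 < σ < σ₀`, every flow family, admissible window, `t > 0`
and every fixed number `L ≥ 1` of epochs, the mean number of particles without a collision during an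
epoch (`n_N / L → ∞` mean free times) is `o(N+1)` — the `m = 0` case of FewCollisionsRare, N-uniform
along the NON-equilibrium law; NECESSARY for the crux by Disproof F3 (`fewIdle_of_dbi`,
`nine_mul_idleFrac_le_ipr`) and this is where the growth hypothesis `Δ_N (N+1)^{1/3} → ∞` is consumed
(equilibrium version super-exponential by ballistic tubes, line `ballistic-tubes`; transfer by the
`O(N)` entropy budget, `KipnisLandim1999_A1_8_2_holds`). Why it might fail: comoving cold clusters at
positive density under the evolved law. -/
theorem stub_fewIdle :
    ∀ (a₀ θ₀ : T3 → ℝ) (u₀ : T3 → V3), NiceProfiles a₀ θ₀ u₀ →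
      ∃ σ₀ : ℝ, 0 < σ₀ ∧ ∀ σ : ℝ, 0 < σ → σ < σ₀ →
        ∀ (Φ : Flows σ) (Δ : ℕ → ℝ), AdmissibleWindow Δ → ∀ t : ℝ, 0 < t →
          ∀ L : ℕ, 0 < L → FewIdleAt σ a₀ θ₀ u₀ Φ Δ t L := by
  sorry

/-- STUB 4 (DISSIPATION SUPPLY from few idle particles, L). Given the bookkeeping, for small `σ` and
every `(Φ, Δ, t)`: if every epoch leaves only `o(N+1)` particles idle (for every `L ≥ 1`; by pigeonhole
on `3L` epochs all but `o(N)` particles then collide `≥ 3` times per epoch), then for some `c > 0`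
independent of `L` the epochs' fold steps dissipate `≥ c · Φ(epoch start)` up to `o(N+1)` in mean.
Mechanism (two own collisions): `Φ_i = Σ_k ‖S_ik‖²` is carried by heavy blocks; a block of mass `a`
receiving share `y` at a contact leaves with traceless part `‖D'‖² ≥ (3/2)(y − a'/3)²` (mass discrepancy
⇒ anisotropy, triage r1-2 (c)), and the NEXT contact with normal `ω'` outside the eigen-bands of `D'`
dissipates `2‖(I−P')S'ω'‖² ≥ κ ‖D'‖²`; partners' blocks at the same source are light except on kin
contacts (column budget `Σ_j a_jk = 3`). Needs only an UPPER conditional density bound for the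
realised normal given a coarse past (eigen-band avoidance in mean — the shield-proof half of card
`share-nondegeneracy-one-flight`, kit R2 `K ∈ [0.6, 1.1]`), never fairness. Why it might fail:
persistently degenerate normals (positional cages: cubic/planar order keeps `stepDiss ≡ 0`, Disproof F5
and `coordinateNormalsNoSplit_holds` — the stub is FALSE on that null kernel, as it must be; its price
off the kernel is card `caged-stratum-pricing`) or a macroscopic share of `Φ` held for a whole epoch by
clone pairs (`K_pq ≈ Φ_p`: zero discrepancy, zero dissipation — the equal-swap chain). -/
theorem stub_supply :
    (∀ σ : ℝ, GramBookkeeping σ) →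
    ∀ (a₀ θ₀ : T3 → ℝ) (u₀ : T3 → V3), NiceProfiles a₀ θ₀ u₀ →
      ∃ σ₀ : ℝ, 0 < σ₀ ∧ ∀ σ : ℝ, 0 < σ → σ < σ₀ →
        ∀ (Φ : Flows σ) (Δ : ℕ → ℝ), AdmissibleWindow Δ → ∀ t : ℝ, 0 < t →
          (∀ L : ℕ, 0 < L → FewIdleAt σ a₀ θ₀ u₀ Φ Δ t L) →
          ∃ c : ℝ, 0 < c ∧ ∀ L : ℕ, 0 < L → SupplyAt c σ a₀ θ₀ u₀ Φ Δ t L := by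
  sorry

/-- STUB 5 (REDUCTION, analysis/measure theory, M). Bookkeeping + subordination at defect `η` +
supply at fraction `c` (every `L`) imply delocalisation at `(σ, Φ, Δ, t)` for `0 < σ ≤ 1/2` (local
Gibbs laws are probability measures). Content: on the good set (full measure, `Alexander.torusFlow_ae_good`)
`steps` is monotone in `s` (`le_collisionCount_iff`), so with `n_ℓ = steps(ℓΔ_N/L)` the jump identity
telescopes to `Φ(n_{ℓ+1}) = Φ(n_ℓ) − diss + gain` per epoch and `epoch_bound` (PROVED above) gives
pathwise `L·Φ(n_L) ≤ (3(N+1) + X₀⁺)/(ηc) + S⁺/c + Σ_ℓ X_ℓ⁺` with the subordination deficits `X_ℓ⁺` of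
the tails `[ℓΔ_N/L, Δ_N]` and the supply deficit `S⁺`; integrate (`lintegral_add_left` — measurability
of the fold functionals along the flow from `HardSphereFlowMeasurable.measurable_collisionCount` /
`measurable_stateAfter` and continuity of `collidePair` in the velocities; `ENNReal.ofReal` algebra):
`E[Φ(n_L)] ≤ (N+1)[3/(ηcL) + ε_N(1/(ηc) + 1/c + L)/L]`, hence with `iprSum_le`
`limsup_N E[ipr] ≤ 9/(ηcL)` for every `L ≥ 1`, i.e. `E[ipr] → 0`. -/
theorem stub_reduction :
    (∀ σ : ℝ, GramBookkeeping σ) →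
    ∀ (a₀ θ₀ : T3 → ℝ) (u₀ : T3 → V3), NiceProfiles a₀ θ₀ u₀ →
      ∀ σ : ℝ, 0 < σ → σ ≤ 1 / 2 →
        ∀ (Φ : Flows σ) (Δ : ℕ → ℝ), AdmissibleWindow Δ → ∀ t : ℝ, 0 < t →
          ∀ η : ℝ, 0 < η → η < 1 → SubordinationAt η σ a₀ θ₀ u₀ Φ Δ t →
          (∃ c : ℝ, 0 < c ∧ ∀ L : ℕ, 0 < L → SupplyAt c σ a₀ θ₀ u₀ Φ Δ t L) →
          Delocalises σ a₀ θ₀ u₀ Φ Δ t := by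
  sorry

/-! ## Composition -/

/-- STATEMENT-LEVEL COMPOSITION (sorry-free, uses no stub): the five stub STATEMENTS give, for all nice
profiles, a threshold `σ₀ := min (min σ_sub σ_idle) (min σ_supply (1/2))` below which every
`(Φ, admissible Δ, t > 0)` delocalises — subordination gives `η`, few-idle feeds supply which gives
`c`, and the reduction concludes. (`Delocalises …` is definitionally the crux's conclusion; the
skeleton theorem `DiffuseBackwardInfluence_of` below plugs the registered stubs into this.) -/
theorem delocalises_of_statements :
    (∀ σ : ℝ, GramBookkeeping σ) →
    ((∀ σ : ℝ, GramBookkeeping σ) →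
      ∀ (a₀ θ₀ : T3 → ℝ) (u₀ : T3 → V3), NiceProfiles a₀ θ₀ u₀ →
        ∃ σ₀ : ℝ, 0 < σ₀ ∧ ∀ σ : ℝ, 0 < σ → σ < σ₀ →
          ∀ (Φ : Flows σ) (Δ : ℕ → ℝ), AdmissibleWindow Δ → ∀ t : ℝ, 0 < t →
            ∃ η : ℝ, 0 < η ∧ η < 1 ∧ SubordinationAt η σ a₀ θ₀ u₀ Φ Δ t) →
    (∀ (a₀ θ₀ : T3 → ℝ) (u₀ : T3 → V3), NiceProfiles a₀ θ₀ u₀ →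
        ∃ σ₀ : ℝ, 0 < σ₀ ∧ ∀ σ : ℝ, 0 < σ → σ < σ₀ →
          ∀ (Φ : Flows σ) (Δ : ℕ → ℝ), AdmissibleWindow Δ → ∀ t : ℝ, 0 < t →
            ∀ L : ℕ, 0 < L → FewIdleAt σ a₀ θ₀ u₀ Φ Δ t L) →
    ((∀ σ : ℝ, GramBookkeeping σ) →
      ∀ (a₀ θ₀ : T3 → ℝ) (u₀ : T3 → V3), NiceProfiles a₀ θ₀ u₀ →
        ∃ σ₀ : ℝ, 0 < σ₀ ∧ ∀ σ : ℝ, 0 < σ → σ < σ₀ →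
          ∀ (Φ : Flows σ) (Δ : ℕ → ℝ), AdmissibleWindow Δ → ∀ t : ℝ, 0 < t →
            (∀ L : ℕ, 0 < L → FewIdleAt σ a₀ θ₀ u₀ Φ Δ t L) →
            ∃ c : ℝ, 0 < c ∧ ∀ L : ℕ, 0 < L → SupplyAt c σ a₀ θ₀ u₀ Φ Δ t L) →
    ((∀ σ : ℝ, GramBookkeeping σ) →
      ∀ (a₀ θ₀ : T3 → ℝ) (u₀ : T3 → V3), NiceProfiles a₀ θ₀ u₀ →
        ∀ σ : ℝ, 0 < σ → σ ≤ 1 / 2 →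
          ∀ (Φ : Flows σ) (Δ : ℕ → ℝ), AdmissibleWindow Δ → ∀ t : ℝ, 0 < t →
            ∀ η : ℝ, 0 < η → η < 1 → SubordinationAt η σ a₀ θ₀ u₀ Φ Δ t →
            (∃ c : ℝ, 0 < c ∧ ∀ L : ℕ, 0 < L → SupplyAt c σ a₀ θ₀ u₀ Φ Δ t L) →
            Delocalises σ a₀ θ₀ u₀ Φ Δ t) →
    ∀ (a₀ θ₀ : T3 → ℝ) (u₀ : T3 → V3), NiceProfiles a₀ θ₀ u₀ →
      ∃ σ₀ : ℝ, 0 < σ₀ ∧ ∀ σ : ℝ, 0 < σ → σ < σ₀ →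
        ∀ (Φ : Flows σ) (Δ : ℕ → ℝ), AdmissibleWindow Δ → ∀ t : ℝ, 0 < t →
          Delocalises σ a₀ θ₀ u₀ Φ Δ t := by
  intro hB hSub hI hSup hR a₀ θ₀ u₀ hP
  obtain ⟨σ₁, hσ₁, H1⟩ := hSub hB a₀ θ₀ u₀ hP
  obtain ⟨σ₂, hσ₂, H2⟩ := hI a₀ θ₀ u₀ hP
  obtain ⟨σ₃, hσ₃, H3⟩ := hSup hB a₀ θ₀ u₀ hP
  refine ⟨min (min σ₁ σ₂) (min σ₃ (1 / 2)), ?_, ?_⟩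
  · exact lt_min (lt_min hσ₁ hσ₂) (lt_min hσ₃ (by norm_num))
  intro σ hσ hσlt Φ Δ hadm t ht
  have h1 : σ < σ₁ := lt_of_lt_of_le hσlt ((min_le_left _ _).trans (min_le_left _ _))
  have h2 : σ < σ₂ := lt_of_lt_of_le hσlt ((min_le_left _ _).trans (min_le_right _ _))
  have h3 : σ < σ₃ := lt_of_lt_of_le hσlt ((min_le_right _ _).trans (min_le_left _ _))
  have h4 : σ ≤ 1 / 2 := (lt_of_lt_of_le hσlt ((min_le_right _ _).trans (min_le_right _ _))).le
  obtain ⟨η, hη, hη1, hsub⟩ := H1 σ hσ h1 Φ Δ hadm t ht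
  have hidle : ∀ L : ℕ, 0 < L → FewIdleAt σ a₀ θ₀ u₀ Φ Δ t L :=
    fun L hL => H2 σ hσ h2 Φ Δ hadm t ht L hL
  obtain ⟨c, hc, hsup⟩ := H3 σ hσ h3 Φ Δ hadm t ht hidle
  exact hR hB a₀ θ₀ u₀ hP σ hσ h4 Φ Δ hadm t ht η hη hη1 hsub ⟨c, hc, hsup⟩

/-- THE SKELETON THEOREM: the crux `CollisionIsometryCLT.DiffuseBackwardInfluence` BY NAME, no
hypotheses; `sorry` lives only in the five registered stubs it invokes (through
`delocalises_of_statements`) — once they are proved this IS the crux proof. The crux's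
`let M …; let ipr …` conclusion is definitionally `Delocalises σ a₀ θ₀ u₀ Φ Δ t` (closed by `exact`). -/
theorem DiffuseBackwardInfluence_of :
    Summit.AtomisticToContinuum.HydrodynamicLimit.Theses.CollisionIsometryCLT.DiffuseBackwardInfluence := by
  intro a₀ θ₀ u₀ ha hθ hu ha0 hθ0
  obtain ⟨σ₀, hσ₀, H⟩ := delocalises_of_statements stub_gramBookkeeping stub_subordination stub_fewIdle
    stub_supply stub_reduction a₀ θ₀ u₀ ⟨ha, hθ, hu, ha0, hθ0⟩
  refine ⟨σ₀, hσ₀, ?_⟩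
  intro σ hσ hσlt M ipr Φ Δ hΔpos hΔ0 hΔinf t ht
  exact H σ hσ hσlt Φ Δ ⟨hΔpos, hΔ0, hΔinf⟩ t ht

end

end Summit.AtomisticToContinuum.HydrodynamicLimit.Cruxes.DiffuseBackwardInfluence.GramCoherenceCascade
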